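import Literature.MathematicalPhysics.QuantumLattice.HubbardFreeCovariance
import Literature.Probability.LatticeModels.TorusFourierMomentBound
import HarnessLib

/-!
# Momentum differences of the torus band: `|ε_L(k + v) - ε_L(k)| ≤ (4π/L) Σ_i |ṽ_i|`

Topic `MathematicalPhysics/QuantumLattice`; companion of `HubbardFreePropagator.lean` / `HubbardFreeCovariance.lean` (`torusBand L k = -2 Σ_i cos p_i`,
`p = latticeMomentum L k = 2πk/L`) and of `HubbardShiftedSliceSymbolDifferences.lean` (a momentum difference of the free symbol
costs `|ξ(k+v) - ξ(k)|` over the square of the denominator).  The weighted-Plancherel route to the `L¹` norms of the slice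
propagators (cell gate-hubbard-kl, R0-SCOPE-2 §5.3 (W2)) takes discrete differences of the symbol in the momentum directions
`v = e_i`; the band moves by at most the arc: `cos` is the real part of a character, `χ_{k+v} - χ_k = χ_k(χ_v - 1)` and the chord
bound `‖e(a) - 1‖ ≤ 2π|ã|/L` (`TorusFourierMomentBound.norm_stdAddChar_sub_one_le_div`) give
`|ε_L(k+v) - ε_L(k)| ≤ 2 Σ_i ‖e(v_i) - 1‖ ≤ (4π/L) Σ_i |ṽ_i|` (Benfatto–Giuliani–Mastropietro 2006, (2.36aa): discrete momentum
derivatives on the finite torus are `O(1/L)` per step).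

* `torusBand_eq_re_torusChar` — `ε_L(k) = -2 Σ_i Re χ_k(e_i)` (`2 ≤ L`);
* **`abs_torusBand_add_sub_le`** — `|ε_L(k + v) - ε_L(k)| ≤ (4π/L) Σ_i |ṽ_i|` (`2 ≤ L`), hence the same for `ξ = ε_L - μ`
  (`abs_nambuXi_add_sub_le`).

Everything is proved; no definitions, no named facts.

## Sources

G. Benfatto, A. Giuliani, V. Mastropietro, Ann. Henri Poincaré 7 (2006) 809–898, (1.4), (2.36aa)
(`BenfattoGiulianiMastropietro2006`); S. Friedli, Y. Velenik, *Statistical Mechanics of Lattice Systems* (2017), §10.4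
(`FriedliVelenik2017`).
-/

noncomputable section

namespace Literature.MathematicalPhysics.QuantumLattice

open Literature.Probability.LatticeModels Finset

variable {L : ℕ} [NeZero L]

/-- **The band is a sum of real parts of characters**: `ε_L(k) = -2 Σ_i Re χ_k(e_i)` for `2 ≤ L`. [cite: FriedliVelenik2017, §10.4] -/
theorem torusBand_eq_re_torusChar (hL : 2 ≤ L) (k : TorusSite 2 L) :
    torusBand L k = -2 * ∑ i, (torusChar k (Pi.single i (1 : ZMod L))).re := by
  rw [torusBand]
  congr 1
  refine sum_congr rfl fun i _ => ?_
  rw [torusChar_re, Fintype.sum_eq_single i fun j hj => by rw [Pi.single_eq_of_ne hj, ZMod.val_zero, Nat.cast_zero, mul_zero]]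
  rw [Pi.single_eq_same, ZMod.val_one'' (by omega), Nat.cast_one, mul_one]

/-- **Momentum differences of the band**: `|ε_L(k + v) - ε_L(k)| ≤ (4π/L) Σ_i |ṽ_i|` for `2 ≤ L`, `ṽ_i = valMinAbs (v i)`.
[cite: BenfattoGiulianiMastropietro2006, (2.36aa)] -/
theorem abs_torusBand_add_sub_le (hL : 2 ≤ L) (k v : TorusSite 2 L) :
    |torusBand L (k + v) - torusBand L k| ≤ 4 * Real.pi / L * ∑ i, |(((v i).valMinAbs : ℤ) : ℝ)| := by
  rw [torusBand_eq_re_torusChar hL, torusBand_eq_re_torusChar hL, ← mul_sub, ← sum_sub_distrib, abs_mul, abs_neg,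
    abs_two, mul_sum]
  have h4 : ∀ i : Fin 2, 4 * Real.pi / L * |(((v i).valMinAbs : ℤ) : ℝ)| = 2 * (2 * Real.pi * |(((v i).valMinAbs : ℤ) : ℝ)| / L) :=
    fun i => by ring
  simp_rw [h4, ← mul_sum]
  refine mul_le_mul_of_nonneg_left ((abs_sum_le_sum_abs _ _).trans (sum_le_sum fun i _ => ?_)) (by norm_num)
  rw [torusChar_add_left, ← Complex.sub_re, ← mul_sub_one]
  calc |(torusChar k (Pi.single i 1) * (torusChar v (Pi.single i 1) - 1)).re|
      ≤ ‖torusChar k (Pi.single i 1) * (torusChar v (Pi.single i 1) - 1)‖ := Complex.abs_re_le_norm _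
    _ = ‖torusChar v (Pi.single i 1) - 1‖ := by rw [norm_mul, norm_torusChar, one_mul]
    _ = ‖(ZMod.stdAddChar (v i) : ℂ) - 1‖ := by rw [torusChar_comm, torusChar_single_left]
    _ ≤ 2 * Real.pi * |(((v i).valMinAbs : ℤ) : ℝ)| / L := norm_stdAddChar_sub_one_le_div (v i)

/-- The same for `ξ = ε_L - μ`: `|ξ(k + v) - ξ(k)| ≤ (4π/L) Σ_i |ṽ_i|`. [cite: BenfattoGiulianiMastropietro2006, (2.36aa)] -/
theorem abs_nambuXi_add_sub_le (hL : 2 ≤ L) (μ : ℝ) (k v : TorusSite 2 L) :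
    |nambuXi L μ (k + v) - nambuXi L μ k| ≤ 4 * Real.pi / L * ∑ i, |(((v i).valMinAbs : ℤ) : ℝ)| := by
  rw [nambuXi, nambuXi, sub_sub_sub_cancel_right]
  exact abs_torusBand_add_sub_le hL k v

end Literature.MathematicalPhysics.QuantumLattice

end
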